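import Literature.Probability.RandomPlanarGeometry.LoewnerSimpleIncrement
import HarnessLib

/-!
# The two accesses at the base of a simple slit

Trunk T-STOCH. For the chordal Loewner chain of a continuous `W` with `W 0 = 0`, generated by a
simple curve `γ` (injective, in `ℍ` for positive times), and `t > 0`, the boundary point
`0 = γ(0)` of `Hₜ = ℍ ∖ γ(0, t]` has **exactly two accesses**: the real zeros of the boundary
extension `f̄ₜ` of `fₜ = gₜ⁻¹` are exactly `x₀(t) = lim_{x↑0} gₜ(x)` and `x₁(t) = lim_{x↓0} gₜ(x)`
(`Loewner.bdryInv_ofReal_eq_zero_iff`, **proved**). This is the sentence "a.s. there are two limit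
points `x₀, x₁` for `g₁(z)` as `z → 0` in `H₁`" of the proof of Rohde–Schramm's Thm. 7.1 in the
case `κ ≤ 4` (p. 911) — classically a statement about the prime ends of a slit domain. The proof
given here is dynamic, by the Loewner equation, and uses no prime-end theory:

* the parameter `r(v)` of the boundary point `f̄ₜ(v) = γ(r(v))` is monotone in `v` on
  `[x₀, Wₜ]` and on `[Wₜ, x₁]` (`Loewner.param_mono_left/right`): if it decreased somewhere on the
  left, an intermediate time `s` would give a shadow (`Loewner.incrShadow`, the real points whose
  boundary value lies on `γ[s, t]`; an interval containing `Wₜ`, `LoewnerSimpleIncrement`)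
  containing a point and `Wₜ` but not a point in between;
* hence a zero `v ∈ (x₀, Wₜ)` of `f̄ₜ` forces `f̄ₜ ≡ 0` on `[x₀, v]`; transporting this interval of
  accesses of `0` back to small times `s` by the real flow of the increment chain (which does not
  contract it, `Loewner.exists_interval_of_forall_notMem_incrShadow`) produces intervals of accesses
  of `0` at time `s` of length `≥ v - x₀`, inside `[x₀(s), x₁(s)]`, whose length is
  `O(sup_{[0,s]} |W| + √s) → 0`: contradiction.

## References

* S. Rohde, O. Schramm, *Basic properties of SLE*, Ann. of Math. 161 (2005), proof of Thm. 7.1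
  (p. 911).
* G. F. Lawler, *Conformally Invariant Processes in the Plane*, AMS (2005), §4.1, §6.2.
* Ch. Pommerenke, *Boundary Behaviour of Conformal Maps*, Springer (1992), §2.4–2.5 (prime ends
  and accessible boundary points; the classical route, not used here).
-/

noncomputable section

open Set Filter Topology Metric Complex Function
open UpperHalfPlane (upperHalfPlaneSet isOpen_upperHalfPlaneSet)
open scoped NNReal

namespace Literature.Probability.RandomPlanarGeometry

namespace Loewner

variable {W : ℝ≥0 → ℝ} {γ : ℝ≥0 → ℂ}

/-- The **left access** of `0` at time `t`: `x₀(t) = sup_{x<0} re gₜ(x) = lim_{x↑0} gₜ(x)`.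
[cite: RohdeSchramm2005, proof of Thm 7.1 (p. 911)] -/
def leftAccess (W : ℝ≥0 → ℝ) (t : ℝ≥0) : ℝ :=
  sSup ((fun x : ℝ ↦ (map W t x).re) '' Iio 0)

/-- The **right access** of `0` at time `t`: `x₁(t) = inf_{x>0} re gₜ(x) = lim_{x↓0} gₜ(x)`.
[cite: RohdeSchramm2005, proof of Thm 7.1 (p. 911)] -/
def rightAccess (W : ℝ≥0 → ℝ) (t : ℝ≥0) : ℝ :=
  sInf ((fun x : ℝ ↦ (map W t x).re) '' Ioi 0)

section Simple

variable (hW : Continuous W) (hW0 : W 0 = 0) (hγ : IsGeneratedByCurve W γ) (hs : IsSimpleTrace γ)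
include hW hW0 hγ hs

/-! ### The two accesses: order, limits, boundary values -/

/-- The values `re gₜ(x)`, `x < 0`, are bounded above (by `Wₜ`). [folklore] -/
theorem bddAbove_image_Iio (t : ℝ≥0) : BddAbove ((fun x : ℝ ↦ (map W t x).re) '' Iio 0) :=
  ⟨W t, by
    rintro _ ⟨x, hx, rfl⟩
    exact (map_ofReal_re_lt_driving_of_isSimpleTrace hW hW0 hγ hs hx t).le⟩

/-- The values `re gₜ(x)`, `x > 0`, are bounded below (by `Wₜ`). [folklore] -/
theorem bddBelow_image_Ioi (t : ℝ≥0) : BddBelow ((fun x : ℝ ↦ (map W t x).re) '' Ioi 0) :=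
  ⟨W t, by
    rintro _ ⟨x, hx, rfl⟩
    exact (driving_lt_map_ofReal_re_of_isSimpleTrace hW hW0 hγ hs hx t).le⟩

/-- `re gₜ(x) ≤ x₀(t)` for `x < 0`. [folklore] -/
theorem map_re_le_leftAccess {x : ℝ} (hx : x < 0) (t : ℝ≥0) : (map W t x).re ≤ leftAccess W t :=
  le_csSup (bddAbove_image_Iio hW hW0 hγ hs t) ⟨x, hx, rfl⟩

/-- `x₁(t) ≤ re gₜ(x)` for `x > 0`. [folklore] -/
theorem rightAccess_le_map_re {x : ℝ} (hx : 0 < x) (t : ℝ≥0) : rightAccess W t ≤ (map W t x).re :=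
  csInf_le (bddBelow_image_Ioi hW hW0 hγ hs t) ⟨x, hx, rfl⟩

/-- `x₀(t) ≤ Wₜ`. [folklore] -/
theorem leftAccess_le_driving (t : ℝ≥0) : leftAccess W t ≤ W t :=
  csSup_le ⟨_, ⟨-1, by norm_num, rfl⟩⟩ (by
    rintro _ ⟨x, hx, rfl⟩
    exact (map_ofReal_re_lt_driving_of_isSimpleTrace hW hW0 hγ hs hx t).le)

/-- `Wₜ ≤ x₁(t)`. [folklore] -/
theorem driving_le_rightAccess (t : ℝ≥0) : W t ≤ rightAccess W t :=
  le_csInf ⟨_, ⟨1, by norm_num, rfl⟩⟩ (by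
    rintro _ ⟨x, hx, rfl⟩
    exact (driving_lt_map_ofReal_re_of_isSimpleTrace hW hW0 hγ hs hx t).le)

/-- `gₜ(x) → x₀(t)` as `x ↑ 0`. [folklore] -/
theorem tendsto_map_re_leftAccess (t : ℝ≥0) :
    Tendsto (fun x : ℝ ↦ (map W t x).re) (𝓝[<] 0) (𝓝 (leftAccess W t)) :=
  ((map_ofReal_re_strictMonoOn_neg_of_isSimpleTrace hW hW0 hγ hs t).monotoneOn).tendsto_nhdsLT
    (bddAbove_image_Iio hW hW0 hγ hs t)

/-- `gₜ(x) → x₁(t)` as `x ↓ 0`. [folklore] -/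
theorem tendsto_map_re_rightAccess (t : ℝ≥0) :
    Tendsto (fun x : ℝ ↦ (map W t x).re) (𝓝[>] 0) (𝓝 (rightAccess W t)) :=
  ((map_ofReal_re_strictMonoOn_pos_of_isSimpleTrace hW hW0 hγ hs t).monotoneOn).tendsto_nhdsGT
    (bddBelow_image_Ioi hW hW0 hγ hs t)

omit hW0 hs in
/-- The boundary extension restricted to the real line is continuous. [folklore] -/
theorem continuous_bdryInv_ofReal (t : ℝ≥0) : Continuous fun v : ℝ ↦ bdryInv W t v :=
  (hγ.continuousOn_bdryInv hW t).comp_continuous continuous_ofReal fun v ↦ by simp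

/-- `f̄ₜ(re gₜ(x)) = x` for real `x ≠ 0`. [folklore] -/
theorem bdryInv_map_re {x : ℝ} (hx : x ≠ 0) (t : ℝ≥0) :
    bdryInv W t (((map W t x).re : ℝ) : ℂ) = x := by
  rw [← map_ofReal_eq_of_isSimpleTrace hW hW0 hγ hs hx t]
  exact bdryInv_map_ofReal hW hW0 hγ hs hx t

/-- **`x₀(t)` is an access of `0`: `f̄ₜ(x₀(t)) = 0`** (continuity of `f̄ₜ` along `gₜ(x) → x₀(t)`,
`x ↑ 0`, where `f̄ₜ(gₜ x) = x → 0`). [cite: RohdeSchramm2005, proof of Thm 7.1 (p. 911)] -/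
theorem bdryInv_leftAccess (t : ℝ≥0) : bdryInv W t (leftAccess W t) = 0 := by
  have h1 : Tendsto (fun x : ℝ ↦ bdryInv W t (((map W t x).re : ℝ) : ℂ)) (𝓝[<] 0)
      (𝓝 (bdryInv W t (leftAccess W t))) :=
    ((continuous_bdryInv_ofReal hW hγ t).tendsto _).comp (tendsto_map_re_leftAccess hW hW0 hγ hs t)
  have h2 : Tendsto (fun x : ℝ ↦ bdryInv W t (((map W t x).re : ℝ) : ℂ)) (𝓝[<] 0) (𝓝 0) := by
    have h : Tendsto (fun x : ℝ ↦ (x : ℂ)) (𝓝[<] (0 : ℝ)) (𝓝 ((0 : ℝ) : ℂ)) :=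
      (continuous_ofReal.tendsto 0).mono_left nhdsWithin_le_nhds
    rw [ofReal_zero] at h
    refine h.congr' ?_
    filter_upwards [self_mem_nhdsWithin] with x hx
    exact (bdryInv_map_re hW hW0 hγ hs (ne_of_lt hx) t).symm
  exact tendsto_nhds_unique h1 h2

/-- **`x₁(t)` is an access of `0`: `f̄ₜ(x₁(t)) = 0`.** [cite: RohdeSchramm2005, proof of Thm 7.1 (p. 911)] -/
theorem bdryInv_rightAccess (t : ℝ≥0) : bdryInv W t (rightAccess W t) = 0 := by
  have h1 : Tendsto (fun x : ℝ ↦ bdryInv W t (((map W t x).re : ℝ) : ℂ)) (𝓝[>] 0)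
      (𝓝 (bdryInv W t (rightAccess W t))) :=
    ((continuous_bdryInv_ofReal hW hγ t).tendsto _).comp (tendsto_map_re_rightAccess hW hW0 hγ hs t)
  have h2 : Tendsto (fun x : ℝ ↦ bdryInv W t (((map W t x).re : ℝ) : ℂ)) (𝓝[>] 0) (𝓝 0) := by
    have h : Tendsto (fun x : ℝ ↦ (x : ℂ)) (𝓝[>] (0 : ℝ)) (𝓝 ((0 : ℝ) : ℂ)) :=
      (continuous_ofReal.tendsto 0).mono_left nhdsWithin_le_nhds
    rw [ofReal_zero] at h
    refine h.congr' ?_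
    filter_upwards [self_mem_nhdsWithin] with x hx
    exact (bdryInv_map_re hW hW0 hγ hs (ne_of_gt hx) t).symm
  exact tendsto_nhds_unique h1 h2

/-- For `t > 0`: `x₀(t) < Wₜ` (`f̄ₜ(Wₜ) = γ(t) ∈ ℍ` is not `0`). [folklore] -/
theorem leftAccess_lt_driving {t : ℝ≥0} (ht : 0 < t) : leftAccess W t < W t := by
  refine lt_of_le_of_ne (leftAccess_le_driving hW hW0 hγ hs t) fun h ↦ ?_
  have h0 := bdryInv_leftAccess hW hW0 hγ hs t
  rw [h, hγ.bdryInv_driving hW t] at h0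
  have := hs.2 t ht
  rw [h0, zero_im] at this
  exact lt_irrefl _ this

/-- For `t > 0`: `Wₜ < x₁(t)`. [folklore] -/
theorem driving_lt_rightAccess {t : ℝ≥0} (ht : 0 < t) : W t < rightAccess W t := by
  refine lt_of_le_of_ne (driving_le_rightAccess hW hW0 hγ hs t) fun h ↦ ?_
  have h0 := bdryInv_rightAccess hW hW0 hγ hs t
  rw [← h, hγ.bdryInv_driving hW t] at h0
  have := hs.2 t ht
  rw [h0, zero_im] at this
  exact lt_irrefl _ this

/-- **Left of `x₀(t)` the boundary values are negative reals**: `v < x₀(t)` is `v = re gₜ(x)` for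
some `x < 0`, and `f̄ₜ(v) = x`. [folklore] -/
theorem exists_eq_map_re_of_lt_leftAccess {t : ℝ≥0} {v : ℝ} (hv : v < leftAccess W t) :
    ∃ x : ℝ, x < 0 ∧ (map W t x).re = v ∧ bdryInv W t v = x := by
  obtain ⟨_, ⟨x₀, hx₀, rfl⟩, hvx₀⟩ := exists_lt_of_lt_csSup
    (⟨_, ⟨-1, by norm_num, rfl⟩⟩ : ((fun x : ℝ ↦ (map W t x).re) '' Iio 0).Nonempty) hv
  obtain ⟨y, hy, hyv⟩ := exists_map_ofReal_re_eq_of_le_of_neg hW hW0 hγ hs hx₀ t hvx₀.le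
  have hy0 : y < 0 := lt_of_le_of_lt hy hx₀
  refine ⟨y, hy0, hyv, ?_⟩
  rw [← hyv]
  exact bdryInv_map_re hW hW0 hγ hs hy0.ne t

/-- **Right of `x₁(t)` the boundary values are positive reals.** [folklore] -/
theorem exists_eq_map_re_of_rightAccess_lt {t : ℝ≥0} {v : ℝ} (hv : rightAccess W t < v) :
    ∃ x : ℝ, 0 < x ∧ (map W t x).re = v ∧ bdryInv W t v = x := by
  obtain ⟨_, ⟨x₀, hx₀, rfl⟩, hvx₀⟩ := exists_lt_of_csInf_lt
    (⟨_, ⟨1, by norm_num, rfl⟩⟩ : ((fun x : ℝ ↦ (map W t x).re) '' Ioi 0).Nonempty) hv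
  obtain ⟨y, hy, hyv⟩ := exists_map_ofReal_re_eq_of_le hW hW0 hγ hs hx₀ t hvx₀.le
  have hy0 : 0 < y := hx₀.trans_le hy
  refine ⟨y, hy0, hyv, ?_⟩
  rw [← hyv]
  exact bdryInv_map_re hW hW0 hγ hs hy0.ne' t

/-- **The real zeros of `f̄ₜ` lie in `[x₀(t), x₁(t)]`.** [cite: RohdeSchramm2005, proof of Thm 7.1 (p. 911)] -/
theorem mem_Icc_of_bdryInv_eq_zero {t : ℝ≥0} {v : ℝ} (hv : bdryInv W t v = 0) :
    v ∈ Icc (leftAccess W t) (rightAccess W t) := by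
  constructor
  · by_contra h
    obtain ⟨x, hx, -, hval⟩ := exists_eq_map_re_of_lt_leftAccess hW hW0 hγ hs (not_le.1 h)
    rw [hv] at hval
    exact hx.ne (by exact_mod_cast hval.symm)
  · by_contra h
    obtain ⟨x, hx, -, hval⟩ := exists_eq_map_re_of_rightAccess_lt hW hW0 hγ hs (not_le.1 h)
    rw [hv] at hval
    exact hx.ne' (by exact_mod_cast hval.symm)

/-- **Between the accesses the boundary values lie on the curve**: for `v ∈ [x₀(t), x₁(t)]`,
`f̄ₜ(v) ∈ γ[0, t]`. [cite: RohdeSchramm2005, proof of Thm 7.1 (p. 911)] -/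
theorem bdryInv_mem_image_of_mem_Icc {t : ℝ≥0} {v : ℝ}
    (hv : v ∈ Icc (leftAccess W t) (rightAccess W t)) :
    bdryInv W t v ∈ γ '' Icc 0 t := by
  rcases bdryInv_ofReal_dichotomy hW hW0 hγ hs t v with h | ⟨x, hx, hxv, -⟩
  · exact h
  · exfalso
    have hre : (map W t x).re = v := by
      have := congrArg Complex.re hxv; simpa using this
    rcases lt_or_gt_of_ne hx with hneg | hpos
    · -- `v = gₜ x < gₜ (x/2) ≤ x₀`
      have h1 := map_ofReal_re_strictMonoOn_neg_of_isSimpleTrace hW hW0 hγ hs t hneg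
        (show x / 2 ∈ Iio (0 : ℝ) by simp; linarith) (by linarith)
      have h2 := map_re_le_leftAccess hW hW0 hγ hs (show x / 2 < 0 by linarith) t
      simp only at h1
      linarith [hv.1]
    · have h1 := map_ofReal_re_strictMonoOn_pos_of_isSimpleTrace hW hW0 hγ hs t
        (show x / 2 ∈ Ioi (0 : ℝ) by simp; linarith) hpos (by linarith)
      have h2 := rightAccess_le_map_re hW hW0 hγ hs (show 0 < x / 2 by linarith) t
      simp only at h1
      linarith [hv.2]

/-- **Size of the accesses**: if `|W| ≤ S` on `[0, t]` then `x₁(t) ≤ 2S + 13√t`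
(`x₁(t) ≤ gₜ(x) ≤ x + 2S + 13√t` for every `x > 0`). [cite: Lawler2005, Ch. 4 §4.1 (Lemma 4.13)] -/
theorem rightAccess_le {t : ℝ≥0} {S : ℝ} (hS : ∀ r ∈ Icc (0 : ℝ) t, |W r.toNNReal| ≤ S) :
    rightAccess W t ≤ 2 * S + 13 * Real.sqrt t := by
  refine le_of_forall_pos_lt_add fun ε hε ↦ ?_
  have hx : (0 : ℝ) < ε / 2 := by positivity
  have h1 := rightAccess_le_map_re hW hW0 hγ hs hx t
  have h2 := abs_map_ofReal_re_sub_self_le hW hW0 hγ hs hS hx.ne'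
  rw [abs_le] at h2
  linarith [h2.2]

/-- `-(2S + 13√t) ≤ x₀(t)`. [cite: Lawler2005, Ch. 4 §4.1 (Lemma 4.13)] -/
theorem le_leftAccess {t : ℝ≥0} {S : ℝ} (hS : ∀ r ∈ Icc (0 : ℝ) t, |W r.toNNReal| ≤ S) :
    -(2 * S + 13 * Real.sqrt t) ≤ leftAccess W t := by
  rw [neg_le]
  refine le_of_forall_pos_lt_add fun ε hε ↦ ?_
  have hx : -(ε / 2) < (0 : ℝ) := by linarith
  have h1 := map_re_le_leftAccess hW hW0 hγ hs hx t
  have h2 := abs_map_ofReal_re_sub_self_le hW hW0 hγ hs hS hx.ne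
  rw [abs_le] at h2
  linarith [h2.1]

/-! ### Monotonicity of the curve parameter along the boundary -/

/-- **The curve parameter is monotone on the left of the driving value.** If `u₁ < u₂ ≤ Wₜ`,
`f̄ₜ(u₁) = γ(r₁)`, `f̄ₜ(u₂) = γ(r₂)` with `r₁, r₂ ≤ t`, then `r₁ ≤ r₂`: otherwise, for `s` between
`r₂` and `r₁`, the shadow at `(s, t)` would contain `u₁` and `Wₜ` but not `u₂ ∈ [u₁, Wₜ]`, though it
is an interval. [cite: RohdeSchramm2005, proof of Thm 7.1 (p. 911)] -/
theorem param_mono_left {t : ℝ≥0} {u₁ u₂ : ℝ} (hu : u₁ ≤ u₂) (hu₂ : u₂ ≤ W t) {r₁ r₂ : ℝ≥0}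
    (hr₁ : r₁ ≤ t) (h₁ : bdryInv W t u₁ = γ r₁) (h₂ : bdryInv W t u₂ = γ r₂) : r₁ ≤ r₂ := by
  by_contra hlt
  rw [not_le] at hlt
  -- an intermediate time `s ∈ (r₂, r₁)`
  obtain ⟨s, hs₂, hs₁⟩ := exists_between hlt
  have hs0 : 0 < s := lt_of_le_of_lt bot_le hs₂
  have hst : s ≤ t := hs₁.le.trans hr₁
  obtain ⟨u, rfl⟩ : ∃ u, t = s + u := ⟨t - s, (add_tsub_cancel_of_le hst).symm⟩
  -- `u₁` and `W t` are in the shadow, hence `u₂` is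
  have hu₁S : u₁ ∈ incrShadow W γ s u := ⟨r₁, ⟨hs₁.le, hr₁⟩, h₁.symm⟩
  have hWS := driving_mem_incrShadow hγ hW s u
  have hu₂S : u₂ ∈ incrShadow W γ s u :=
    (ordConnected_incrShadow hγ hs hW hW0 hs0 u).out hu₁S hWS ⟨hu, hu₂⟩
  -- but `f̄ₜ(u₂) = γ r₂` with `r₂ < s`
  obtain ⟨r, hr, hru⟩ := hu₂S
  have : r = r₂ := hs.1 (hru.trans h₂)
  rw [this] at hr
  exact absurd hr.1 (not_le.2 hs₂)

/-- **The curve parameter is antitone on the right of the driving value.**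
[cite: RohdeSchramm2005, proof of Thm 7.1 (p. 911)] -/
theorem param_anti_right {t : ℝ≥0} {u₁ u₂ : ℝ} (hu : u₁ ≤ u₂) (hu₁ : W t ≤ u₁) {r₁ r₂ : ℝ≥0}
    (hr₂ : r₂ ≤ t) (h₁ : bdryInv W t u₁ = γ r₁) (h₂ : bdryInv W t u₂ = γ r₂) : r₂ ≤ r₁ := by
  by_contra hlt
  rw [not_le] at hlt
  obtain ⟨s, hs₁, hs₂⟩ := exists_between hlt
  have hs0 : 0 < s := lt_of_le_of_lt bot_le hs₁
  have hst : s ≤ t := hs₂.le.trans hr₂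
  obtain ⟨u, rfl⟩ : ∃ u, t = s + u := ⟨t - s, (add_tsub_cancel_of_le hst).symm⟩
  have hu₂S : u₂ ∈ incrShadow W γ s u := ⟨r₂, ⟨hs₂.le, hr₂⟩, h₂.symm⟩
  have hWS := driving_mem_incrShadow hγ hW s u
  have hu₁S : u₁ ∈ incrShadow W γ s u :=
    (ordConnected_incrShadow hγ hs hW hW0 hs0 u).out hWS hu₂S ⟨hu₁, hu⟩
  obtain ⟨r, hr, hru⟩ := hu₁S
  have : r = r₁ := hs.1 (hru.trans h₁)
  rw [this] at hr
  exact absurd hr.1 (not_le.2 hs₁)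

/-! ### No interval of accesses of `0` -/

/-- **An interval of accesses of `0` is impossible** (`t > 0`): if `f̄ₜ ≡ 0` on `[v₁, v₂]` then
`v₁ = v₂`. For every `s ∈ (0, t)` the interval misses the shadow at `(s, t)` (`γ(0) ∉ γ[s, t]`), so
it is the non-contracting image of an interval of accesses of `0` at time `s`
(`exists_interval_of_forall_notMem_incrShadow`), which lies in `[x₀(s), x₁(s)]`, of length
`O(sup_{[0,s]} |W| + √s) → 0` as `s → 0`. [cite: RohdeSchramm2005, proof of Thm 7.1 (p. 911)] -/
theorem eq_of_forall_bdryInv_eq_zero {t : ℝ≥0} (ht : 0 < t) {v₁ v₂ : ℝ} (hv : v₁ ≤ v₂)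
    (hzero : ∀ v ∈ Icc v₁ v₂, bdryInv W t v = 0) : v₁ = v₂ := by
  by_contra hne
  have hℓ : 0 < v₂ - v₁ := by
    rcases hv.lt_or_eq with h | h
    · linarith
    · exact absurd h hne
  -- choose `s ∈ (0, t)` small: `|W| ≤ ε` on `[0, s]` and `13 √s ≤ ε`, with `8 ε < v₂ - v₁`
  set ε : ℝ := (v₂ - v₁) / 10 with hε
  have hεpos : 0 < ε := by positivity
  obtain ⟨δ, hδ, hδW⟩ := Metric.continuous_iff.1 hW 0 ε hεpos
  set σ : ℝ := min ((t : ℝ) / 2) (min (δ / 2) ((ε / 13) ^ 2)) with hσ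
  have hσpos : 0 < σ := by positivity
  set s : ℝ≥0 := ⟨σ, hσpos.le⟩ with hsdef
  have hscoe : (s : ℝ) = σ := rfl
  have hs0 : 0 < s := hσpos
  have hst : s < t := by
    rw [← NNReal.coe_lt_coe, hscoe]
    have : σ ≤ (t : ℝ) / 2 := min_le_left _ _
    have ht' : (0 : ℝ) < t := ht
    linarith
  obtain ⟨u, htu⟩ : ∃ u, t = s + u := ⟨t - s, (add_tsub_cancel_of_le hst.le).symm⟩
  -- `|W| ≤ ε` on `[0, s]`
  have hS : ∀ r ∈ Icc (0 : ℝ) s, |W r.toNNReal| ≤ ε := by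
    intro r hr
    have hdist : dist r.toNNReal (0 : ℝ≥0) < δ := by
      rw [NNReal.dist_eq, NNReal.coe_zero, sub_zero, Real.coe_toNNReal _ hr.1, abs_of_nonneg hr.1]
      have : σ ≤ δ / 2 := (min_le_right _ _).trans (min_le_left _ _)
      linarith [hr.2]
    have := hδW _ hdist
    rw [hW0, Real.dist_eq, sub_zero] at this
    exact this.le
  have hsqrt : 13 * Real.sqrt s ≤ ε := by
    have h1 : (s : ℝ) ≤ (ε / 13) ^ 2 := (min_le_right _ _).trans (min_le_right _ _)
    have h2 : Real.sqrt s ≤ ε / 13 := by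
      rw [← Real.sqrt_sq (by positivity : (0 : ℝ) ≤ ε / 13)]
      exact Real.sqrt_le_sqrt h1
    linarith
  -- the interval misses the shadow at `(s, t)`
  have hoff : ∀ v ∈ Icc v₁ v₂, v ∉ incrShadow W γ s u := by
    intro v hv' hvS
    obtain ⟨r, hr, hrv⟩ := hvS
    rw [← htu, hzero v hv'] at hrv
    -- `γ r = 0 = γ 0` with `r ≥ s > 0`
    have hr0 : r = 0 := hs.1 (by rw [hrv, hγ.apply_zero, hW0, ofReal_zero])
    rw [hr0] at hr
    exact absurd hr.1 (not_le.2 hs0)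
  obtain ⟨y₁, y₂, hy, hlen, hsign, hval⟩ :=
    exists_interval_of_forall_notMem_incrShadow hγ hs hW hW0 hs0 u hv hoff
  -- the transported points `y + W s`, `y ∈ [y₁, y₂]`, are accesses of `0` at time `s`
  have hacc : ∀ y ∈ Icc y₁ y₂, bdryInv W s ((y + W s : ℝ) : ℂ) = 0 := by
    intro y hy'
    obtain ⟨hmem, hv'⟩ := hval y hy'
    rw [hv', ← htu]
    exact hzero _ hmem
  -- hence in `[x₀(s), x₁(s)]`, an interval of length `≤ 2 (2ε + 13√s) ≤ 6 ε`
  have h₁ := (mem_Icc_of_bdryInv_eq_zero hW hW0 hγ hs (hacc y₁ (left_mem_Icc.2 hy))).1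
  have h₂ := (mem_Icc_of_bdryInv_eq_zero hW hW0 hγ hs (hacc y₂ (right_mem_Icc.2 hy))).2
  have hR := rightAccess_le hW hW0 hγ hs hS
  have hL := le_leftAccess hW hW0 hγ hs hS
  linarith

/-! ### Exactly two accesses -/

/-- **No access of `0` strictly between `x₀(t)` and `Wₜ`** (`t > 0`): such an access `v` would
make `f̄ₜ ≡ 0` on `[x₀(t), v]` by monotonicity of the curve parameter, contradicting
`eq_of_forall_bdryInv_eq_zero`. [cite: RohdeSchramm2005, proof of Thm 7.1 (p. 911)] -/
theorem bdryInv_ne_zero_of_mem_Ioc_left {t : ℝ≥0} (ht : 0 < t) {v : ℝ}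
    (hv : v ∈ Ioc (leftAccess W t) (W t)) : bdryInv W t v ≠ 0 := by
  intro hv0
  have hflat : ∀ v' ∈ Icc (leftAccess W t) v, bdryInv W t v' = 0 := by
    intro v' hv'
    have hv'I : v' ∈ Icc (leftAccess W t) (rightAccess W t) :=
      ⟨hv'.1, hv'.2.trans (hv.2.trans (driving_le_rightAccess hW hW0 hγ hs t))⟩
    obtain ⟨r, hr, hrv'⟩ := bdryInv_mem_image_of_mem_Icc hW hW0 hγ hs hv'I
    -- the parameter of `v'` is squeezed between those of `x₀` (namely `0`) and of `v` (namely `0`)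
    have hγ0 : γ 0 = 0 := by rw [hγ.apply_zero, hW0, ofReal_zero]
    have hle : r ≤ 0 := param_mono_left hW hW0 hγ hs hv'.2 hv.2 hr.2 hrv'.symm (by rw [hv0, hγ0])
    rw [← hrv', le_antisymm hle bot_le, hγ0]
  have := eq_of_forall_bdryInv_eq_zero hW hW0 hγ hs ht hv.1.le hflat
  exact hv.1.ne this

/-- **No access of `0` strictly between `Wₜ` and `x₁(t)`.** [cite: RohdeSchramm2005, proof of Thm 7.1 (p. 911)] -/
theorem bdryInv_ne_zero_of_mem_Ico_right {t : ℝ≥0} (ht : 0 < t) {v : ℝ}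
    (hv : v ∈ Ico (W t) (rightAccess W t)) : bdryInv W t v ≠ 0 := by
  intro hv0
  have hflat : ∀ v' ∈ Icc v (rightAccess W t), bdryInv W t v' = 0 := by
    intro v' hv'
    have hv'I : v' ∈ Icc (leftAccess W t) (rightAccess W t) :=
      ⟨(leftAccess_le_driving hW hW0 hγ hs t).trans (hv.1.trans hv'.1), hv'.2⟩
    obtain ⟨r, hr, hrv'⟩ := bdryInv_mem_image_of_mem_Icc hW hW0 hγ hs hv'I
    have hγ0 : γ 0 = 0 := by rw [hγ.apply_zero, hW0, ofReal_zero]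
    have hle : r ≤ 0 := param_anti_right hW hW0 hγ hs hv'.1 hv.1 hr.2 (by rw [hv0, hγ0]) hrv'.symm
    rw [← hrv', le_antisymm hle bot_le, hγ0]
  have := eq_of_forall_bdryInv_eq_zero hW hW0 hγ hs ht hv.2.le hflat
  exact hv.2.ne this

/-- **Exactly two accesses at the base of a simple slit.** For the chain of a continuous `W`,
`W 0 = 0`, generated by a simple curve `γ`, and `t > 0`: a real `v` has `f̄ₜ(v) = 0 = γ(0)` iff
`v = x₀(t)` or `v = x₁(t)` — the two limit points of `gₜ(x)`, `x → 0∓`. This is "there are two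
limit points `x₀, x₁` for `g₁(z)` as `z → 0` in `H₁`" (Rohde–Schramm (2005), proof of Thm. 7.1,
`κ ≤ 4`, p. 911), proved here from the Loewner equation. [cite: RohdeSchramm2005, proof of Thm 7.1 (p. 911)] -/
theorem bdryInv_ofReal_eq_zero_iff {t : ℝ≥0} (ht : 0 < t) (v : ℝ) :
    bdryInv W t v = 0 ↔ v = leftAccess W t ∨ v = rightAccess W t := by
  constructor
  · intro hv
    have hI := mem_Icc_of_bdryInv_eq_zero hW hW0 hγ hs hv
    by_contra hne
    push Not at hne
    rcases le_or_gt v (W t) with hle | hgt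
    · exact bdryInv_ne_zero_of_mem_Ioc_left hW hW0 hγ hs ht ⟨lt_of_le_of_ne hI.1 (Ne.symm hne.1), hle⟩ hv
    · exact bdryInv_ne_zero_of_mem_Ico_right hW hW0 hγ hs ht ⟨hgt.le, lt_of_le_of_ne hI.2 hne.2⟩ hv
  · rintro (rfl | rfl)
    · exact bdryInv_leftAccess hW hW0 hγ hs t
    · exact bdryInv_rightAccess hW hW0 hγ hs t

end Simple

end Loewner

end Literature.Probability.RandomPlanarGeometry
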